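import Mathlib.MeasureTheory.Measure.Dirac
import Mathlib.Analysis.Calculus.FDeriv.Basic
import Literature.Probability.LatticeModels.RandomWalkLoopMeasure
import Literature.Probability.RandomPlanarGeometry.LoopErasure
import HarnessLib

/-!
# Chordal loop-erased random walk converges to chordal SLE₂ (Lawler–Viklund 2021), modulo reparametrisation

Topic `Probability/RandomPlanarGeometry`; namespace `Literature.Probability.RandomPlanarGeometry`,
grouping sub-namespace `ChordalLERW` (the discrete set-up of the paper). A NAMED FACT
(`def … : Prop`, no proof claimed) with the definitions it needs, vendored by a grounder of route
`Summits/CriticalPhenomena/SAWScalingLimit/Theses/SAWLoopAvoidanceChaos`: the informal mechanism of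
its cruxes `LatticeIsChaos` (stmt-CriticalPhenomena-4522) / `LatticeIsChaosSome` (4525) and of the
foreseen layer-2 child "L2" invokes "chordal LERW_δ → SLE₂ (LSW04)", which two grounding passes
(items 4524, 4527 notes of 2026-08-15) recorded as a printed input not yet in the tree.

## Source (read on the held text `paper:arxiv-1603.05203`, arXiv page numbers of that text)

G. F. Lawler, F. Viklund, *Convergence of loop-erased random walk in the natural parameterization*,
Duke Math. J. **170** (2021), no. 10, doi:10.1215/00127094-2020-0075, arXiv:1603.05203
[LawlerViklund2021].

* §2.1 (p. 7), discrete set-up: for a finite `A ⊂ ℤ²`, `∂ₑA` = edges of `ℤ²` with exactly one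
  endpoint in `A`, written through their midpoint `a`, with endpoints `a₋ ∉ A`, `a₊ ∈ A`;
  `𝒜` = triples `(A, a, b)`, `A` finite simply connected containing the origin, `a, b ∈ ∂ₑA`,
  `a₋ ≠ b₋` (`a₊ = b₊` allowed); `𝒦_A(z, w)` = nearest-neighbour walks from `z` to `w` "otherwise
  staying in `A`", weight `p(ω) = 4^{-|ω|}`, total mass `G_A(z, w)`; `𝒦_A(a, b)` = the walks
  `e_a ⊕ ω ⊕ e_b^R`, `ω ∈ 𝒦_A(a₊, b₊)`, total mass `H_{∂A}(a, b) = G_A(a₊, b₊)/16`; `LE` = the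
  CHRONOLOGICAL loop erasure (`s₀ = max{j : ω_j = ω₀}`, …), with
  `LE[e_a ⊕ ω ⊕ e_b^R] = e_a ⊕ LE[ω] ⊕ e_b^R`; the loop-erased measure
  `P̂_{A,a,b}(η) = ∑_{ω ∈ 𝒦_A(a,b), LE(ω) = η} p(ω)` and the LERW law `P_{A,a,b} = P̂_{A,a,b}/H_{∂A}(a,b)`
  ("the probability law of loop-erased random walk (LERW) in `A` from `a` to `b`").
* §2.3 (pp. 8–9), scaling: `η = [η₀ = a₋, η₁ = a₊, …, ηₙ = b₊, η_{n+1} = b₋]` is run "from `a` to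
  `b` along `η` at speed one", `η(0) = a`, `η(n) = b`, `η(j − ½) = η_j`, linear interpolation, then
  `η^N(t) = N⁻¹ η(t c_* N^{5/4})`; `P^N_{A,a,b}` = the law of the scaled curve. "We will assume that
  we have a bounded analytic simply connected domain `D` containing the origin with analytic
  boundary and two distinct boundary points `a′, b′`." "If `N > 0`, let `A = A_{N,D}` be the
  connected component containing the origin of the set of `ζ ∈ ℤ²` with `𝒮_ζ ⊂ ND`"
  (`𝒮_ζ` = closed unit square centred at `ζ`). `μ_D(a′, b′)` = chordal SLE₂ in `D` from `a′` to `b′`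
  (defined by conformal invariance, §2.2 p. 8) with the natural parametrisation; `ρ` = the metric of
  §1 p. 3 (display (metric)) on parametrised curves, `ρ(γ¹, γ²) = inf_α [sup |α(t) − t| + sup |γ²(α(t)) − γ¹(t)|]`
  over increasing homeomorphisms `α` of the parameter intervals; `℘_ρ` its Prokhorov metric.
* **Theorem of §2.3** ("complete statement of main result", labelled `thm:main_complete`; rough
  form Thm 1.1 p. 4): "Let `D` be a bounded analytic domain containing the origin with distinct
  boundary points `a′, b′`. For each `N`, let `A_N = A_{N,D}` and let `a_N, b_N ∈ ∂ₑA_N` with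
  `ǎ := a_N/N → a′`, `b̌ := b_N/N → b′` (`N → ∞`). Then `lim_{N→∞} P^N_{A_N,a_N,b_N} = μ_D(a′, b′)`,
  where the convergence is with respect to the Prokhorov metric as above."
  (p. 9: "This result has been proved previously for convergence in capacity parametrization using
  a slightly different coupling, see [LSW04, Zhan]"; Thm 1.1 gives the rate `ε_N = c (log N)^{-1/60}`.)

## What is vendored (fact = print ∘ forgetting the parametrisation)

The tree's curve space is `CurveClass ℂ` = curves MODULO REPARAMETRISATION (`CurveSpace.lean`). The
forgetful map (parametrised curve, `ρ`) ↦ (class, quotient sup-metric) is `1`-Lipschitz (rescale both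
parameter intervals affinely to `[0,1]`; every admissible `α` of `ρ` becomes an increasing
homeomorphism of `[0,1]`, and `ρ ≥` the reparametrised sup-distance; `Curve.lipschitzWith_mk`), so
Prokhorov convergence for `ρ` implies weak convergence of the class laws, and the class law of
`μ_D(a′,b′)` (SLE₂ in ANY parametrisation) is the tree's chordal SLE₂ law `IsSLELaw 2 D` (law of the
class of the conformal image of the SLE₂ trace, `SLE.lean`; unique, `SLEUniquenessInLaw`). The fact
`ChordalLERW.lawlerViklund_tendsto_sle_two` below is exactly this COROLLARY: for an analytic Jordan
domain `D ∋ 0` with marked points `a′ = D.pt 0`, `b′ = D.pt 1`, and boundary edges `a_N, b_N` of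
`A_{N,D}` with `a_N/N → a′`, `b_N/N → b′`, the class laws of the scaled LERW polylines converge weakly
(bounded continuous test functions, `N → ∞` in `ℕ`) to the chordal SLE₂ law of `D`. It is WEAKER than
the print (parametrisation and rate forgotten), never stronger, with two bookkeeping conventions
spelled out at the declarations: (i) "for each `N`" is read "for all large `N`" (for small `N` the
set `A_{N,D}` may be empty and has no boundary edge; only the tail enters a limit); (ii) the walk
`e_a ⊕ ω ⊕ e_b^R` is represented by its interior part `ω ∈ 𝒦_A(a₊, b₊)`, the two half-edges being
restored in the polyline through the midpoints `a`, `b` (the constant factor `1/16` cancels in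
`P̂/H`, p. 7: "`H_{∂A}(a,b) = G_A(a₊,b₊)/16`").

## Dictionary to the hub's lattice objects (NOT claimed, for provers/planners)

The tree's chordal LERW law `Literature.Probability.LatticeModels.LERW.law Ω δ a b`
(`RandomWalkLoopMeasure.lean`) is `q̂/G_{Ω_δ}(a,b)` on `SAW.DomainSAW Ω δ a b` for the discrete domain
`Ω_δ = meshDomain Ω δ` (largest component of `δℤ² ∩ Ω`, closed edges in `Ω̄`) with loop erasure by
Mathlib's `Walk.bypass` (reverse-chronological). With `δ = 1/N`, `a = a₊`, `b = b₊` this is the same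
weighting of the same walks as `P_{A,a,b}` PROVIDED the discrete domains agree (`A_{N,D}` = component
of the origin among sites whose closed square lies in `ND` — a different convention from
`meshDomain`) and modulo the erasure order (chronological vs reverse-chronological erasure have the
same LAW under the reversible weight `4^{-|ω|}`: Lawler 1991, Lemma 7.2.1) — neither identification
is made here. Nothing is claimed for rough Jordan boundaries or for endpoints that are interior
sites approaching the marked prime ends (the hub's `SAW.IsEndpointApprox`): p. 9, "The assumption
that `D` is analytic is of course not necessary … by an approximation argument our main result can
be extended to more general domains, assuming local analyticity at `a′, b′`."

## Related print (context only)

Lawler–Schramm–Werner, Ann. Probab. 32 (2004), Thm 1.1: RADIAL LERW (from an interior point to the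
boundary of a simply connected `D ∌ ∞`) converges to radial SLE₂ modulo reparametrisation
[LawlerSchrammWerner2004]; D. Zhan, Ann. Probab. 36 (2008) (doi:10.1214/07-aop342): chordal case in
capacity parametrisation (text not readable on this hub at vendoring time).
-/

noncomputable section

open MeasureTheory Filter Set
open _root_.Topology
open scoped ENNReal NNReal Classical
open Literature.Probability.LatticeModels

namespace Literature.Probability.RandomPlanarGeometry

namespace ChordalLERW

/-! ### The discrete set-up of [LawlerViklund2021] §2.1, §2.3 -/

/-- `𝒮_ζ = ζ + {x + iy : |x|, |y| ≤ 1/2}`, the closed unit square centred at the site `ζ ∈ ℤ²`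
([LawlerViklund2021] §2.1, p. 7). [cite: LawlerViklund2021, §2.1] -/
def unitSquare (ζ : Site 2) : Set ℂ :=
  {z : ℂ | |z.re - ((ζ 0 : ℤ) : ℝ)| ≤ 1 / 2 ∧ |z.im - ((ζ 1 : ℤ) : ℝ)| ≤ 1 / 2}

/-- The sites whose closed unit square lies in the blown-up domain `N·D`:
`{ζ ∈ ℤ² : 𝒮_ζ ⊂ ND}` ([LawlerViklund2021] §2.3, p. 9). [cite: LawlerViklund2021, §2.3] -/
def squareSites (N : ℝ) (D : Set ℂ) : Set (Site 2) :=
  {ζ | unitSquare ζ ⊆ (fun z : ℂ => (N : ℂ) * z) '' D}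

/-- `A_{N,D}`: "the connected component containing the origin of the set of `ζ ∈ ℤ²` with
`𝒮_ζ ⊂ ND`" — the sites of `squareSites N D` joined to `0` by a nearest-neighbour chain inside
`squareSites N D` ([LawlerViklund2021] §2.3, p. 9). Empty (junk) when `𝒮_0 ⊄ ND`, in particular for
small `N`; for a bounded `D` it is finite. [cite: LawlerViklund2021, §2.3] -/
def approxSites (N : ℝ) (D : Set ℂ) : Set (Site 2) :=
  {ζ | ζ ∈ squareSites N D ∧
    Relation.ReflTransGen
      (fun x y : Site 2 => (zdGraph 2).Adj x y ∧ x ∈ squareSites N D ∧ y ∈ squareSites N D) 0 ζ}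

/-- The nearest-neighbour graph of `ℤ²` restricted to a vertex set `A` (as a graph on all of
`Site 2`, sites outside `A` isolated): its walks between points of `A` are exactly the walks of
`𝒦_A(z, w)`, "starting at `z`, ending at `w`, and otherwise staying in `A`" ([LawlerViklund2021]
§2.1, p. 7). [cite: LawlerViklund2021, §2.1] -/
def siteGraph (A : Set (Site 2)) : SimpleGraph (Site 2) :=
  SimpleGraph.fromRel fun x y => (zdGraph 2).Adj x y ∧ x ∈ A ∧ y ∈ A

/-- `(a₋, a₊)` is a **boundary edge** of `A` (an element of `∂ₑA`, oriented "from the outside to the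
inside"): a nearest-neighbour edge of `ℤ²` with `a₋ ∉ A` and `a₊ ∈ A` ([LawlerViklund2021] §2.1,
p. 7). [cite: LawlerViklund2021, §2.1] -/
def IsBoundaryEdge (A : Set (Site 2)) (e : Site 2 × Site 2) : Prop :=
  (zdGraph 2).Adj e.1 e.2 ∧ e.1 ∉ A ∧ e.2 ∈ A

/-- The midpoint `a = (a₋ + a₊)/2 ∈ ℂ` of an edge, by which [LawlerViklund2021] §2.1 (p. 7)
"specify elements of `∂ₑA`" ("We sometimes identify an edge with its midpoint"). [cite: LawlerViklund2021, §2.1] -/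
def edgeMidpoint (e : Site 2 × Site 2) : ℂ :=
  (Site.toComplex e.1 + Site.toComplex e.2) / 2

/-- The scaled polyline `η^N` of a lattice path between two boundary edges, as a curve class: the
piecewise-linear curve from the midpoint `a` through the sites `η₁ = a₊, …, ηₙ = b₊` of the list to
the midpoint `b`, divided by `N` ([LawlerViklund2021] §2.3, pp. 8–9: `η(0) = a`, `η(j − ½) = η_j`,
`η(n) = b`, linear interpolation, `η^N = N⁻¹ η(·)`), taken modulo reparametrisation (so the time
scaling `c_* N^{5/4}` and the tree's dyadic `polyline` timing are immaterial). [cite: LawlerViklund2021, §2.3] -/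
def scaledCurve (N : ℝ) (a b : Site 2 × Site 2) (l : List (Site 2)) : CurveClass ℂ :=
  CurveClass.mk ⟨polyline
    (((edgeMidpoint a :: l.map Site.toComplex) ++ [edgeMidpoint b]).map fun z => (N : ℂ)⁻¹ * z)⟩

/-- **The law `P^N_{A,a,b}` of the scaled chordal LERW in `A` from the boundary edge `a` to the
boundary edge `b`, on curve classes** ([LawlerViklund2021] §2.1 p. 7 and §2.3 p. 9): the walks
`ω ∈ 𝒦_A(a₊, b₊)` (walks of `siteGraph A` from `a₊ = a.2` to `b₊ = b.2`) are weighted by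
`p(ω) = 4^{-|ω|}`, loop-erased CHRONOLOGICALLY (`loopErase` of `LoopErasure.lean` on the vertex list,
the paper's `LE` verbatim; `LE[e_a ⊕ ω ⊕ e_b^R] = e_a ⊕ LE[ω] ⊕ e_b^R`), sent to their scaled polyline
from `a` to `b`, and the resulting measure is normalised by its total mass `G_A(a₊, b₊)`
(`rwGreen`; the printed normalisation `P̂/H_{∂A}` with `H_{∂A}(a,b) = G_A(a₊,b₊)/16` is the same
quotient, the weight `1/16` of the two half-edges cancelling). Junk value `0` if no walk joins `a₊`
to `b₊` in `A` or if `G_A(a₊,b₊) = ∞`. [cite: LawlerViklund2021, §2.1 and §2.3] -/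
def law (N : ℝ) (A : Set (Site 2)) (a b : Site 2 × Site 2) : Measure (CurveClass ℂ) :=
  (rwGreen (siteGraph A) a.2 b.2)⁻¹ •
    Measure.sum fun ω : (siteGraph A).Walk a.2 b.2 =>
      (((1 : ℝ≥0∞) / 4) ^ ω.length) • Measure.dirac (scaledCurve N a b (loopErase ω.support))

/-- A Dobrushin domain has **analytic boundary**: its carrier is the image of the open unit disc
under a map that is conformal (holomorphic and injective) on a strictly larger disc — the
Riemann-map form of "bounded analytic simply connected domain … with analytic boundary"
([LawlerViklund2021] §2.3, p. 9; Schwarz reflection). [folklore] -/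
def HasAnalyticBoundary (D : DobrushinDomain) : Prop :=
  ∃ (R : ℝ) (f : ℂ → ℂ), 1 < R ∧ DifferentiableOn ℂ f (Metric.ball 0 R) ∧
    Set.InjOn f (Metric.ball 0 R) ∧ f '' Metric.ball 0 1 = D.carrier

/-! ### The named fact -/

/-- **Lawler–Viklund 2021 (chordal LERW ⟶ chordal SLE₂), forgetting the parametrisation.**
Printed (§2.3, Theorem `thm:main_complete`; rough form Thm 1.1): for a bounded analytic simply
connected domain `D ∋ 0` with distinct boundary points `a′, b′`, `A_N = A_{N,D}`, and boundary edges
`a_N, b_N ∈ ∂ₑA_N` (`a_{N,−} ≠ b_{N,−}`) with `a_N/N → a′`, `b_N/N → b′`, the scaled LERW laws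
`P^N_{A_N,a_N,b_N}` converge, in the Prokhorov metric of the parametrised-curve metric `ρ`, to chordal
SLE₂ in `D` from `a′` to `b′` with its natural parametrisation. VENDORED COROLLARY (weaker: classes
modulo reparametrisation, no rate): with `a′ = D.pt 0`, `b′ = D.pt 1` the marked points of an
analytic Dobrushin domain containing `0`, and `a, b : ℕ → Site 2 × Site 2` eventually boundary edges
of `A_{N, D}` with distinct outer endpoints whose scaled midpoints tend to `a′, b′`, there is a
chordal SLE₂ law `μ` of `D` (`IsSLELaw 2 D μ`; unique by `SLEUniquenessInLaw`) such that
`∫ f dP^N → ∫ f dμ` for every bounded continuous `f` on `CurveClass ℂ`. "For each `N`" is read as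
"eventually in `N`" (only the tail enters; `A_{N,D} = ∅` for small `N`). Grounds the LSW04/LERW step
of `Summit.CriticalPhenomena.SAWScalingLimit.Theses.SAWLoopAvoidanceChaos.LatticeIsChaos` (informal
mechanism) in the paper's own discretisation; see the module docstring for what is NOT identified
with the hub's `meshDomain`/`LERW.law`/`IsEndpointApprox`. [cite: LawlerViklund2021, Thm 1.1 and §2.3] -/
def lawlerViklund_tendsto_sle_two : Prop :=
  ∀ (D : DobrushinDomain), HasAnalyticBoundary D → (0 : ℂ) ∈ D.carrier →
    ∀ (a b : ℕ → Site 2 × Site 2),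
      (∀ᶠ N : ℕ in atTop, IsBoundaryEdge (approxSites N D.carrier) (a N) ∧
        IsBoundaryEdge (approxSites N D.carrier) (b N) ∧ (a N).1 ≠ (b N).1) →
      Tendsto (fun N : ℕ => ((N : ℂ))⁻¹ * edgeMidpoint (a N)) atTop (𝓝 (D.pt 0)) →
      Tendsto (fun N : ℕ => ((N : ℂ))⁻¹ * edgeMidpoint (b N)) atTop (𝓝 (D.pt 1)) →
      ∃ μ : Measure (CurveClass ℂ), IsSLELaw 2 D μ ∧
        ∀ f : BoundedContinuousFunction (CurveClass ℂ) ℝ,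
          Tendsto (fun N : ℕ => ∫ γ, f γ ∂(law N (approxSites N D.carrier) (a N) (b N)))
            atTop (𝓝 (∫ γ, f γ ∂μ))

/-! ### Sanity checks of the typing (elementary, proved) -/

/-- Adjacency in `siteGraph A`, unfolded: a nearest-neighbour edge of `ℤ²` with both endpoints in
`A`. [folklore] -/
theorem siteGraph_adj_iff {A : Set (Site 2)} {x y : Site 2} :
    (siteGraph A).Adj x y ↔ (zdGraph 2).Adj x y ∧ x ∈ A ∧ y ∈ A := by
  simp only [siteGraph, SimpleGraph.fromRel_adj, ne_eq]
  constructor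
  · rintro ⟨-, h | h⟩
    · exact h
    · exact ⟨h.1.symm, h.2.2, h.2.1⟩
  · intro h
    exact ⟨h.1.ne, Or.inl h⟩

/-- `siteGraph A` is a subgraph of `ℤ²`. [folklore] -/
theorem siteGraph_le_zdGraph (A : Set (Site 2)) : siteGraph A ≤ zdGraph 2 :=
  fun _ _ h => (siteGraph_adj_iff.1 h).1

/-- Every vertex on a walk of `siteGraph A` of positive length lies in `A` ("otherwise staying in
`A`"). [folklore] -/
theorem mem_of_mem_support_of_adj {A : Set (Site 2)} {x y : Site 2} (ω : (siteGraph A).Walk x y)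
    (hx : x ∈ A) {v : Site 2} (hv : v ∈ ω.support) : v ∈ A := by
  induction ω with
  | nil => simp only [SimpleGraph.Walk.support_nil, List.mem_singleton] at hv; exact hv ▸ hx
  | cons h p ih =>
    rw [SimpleGraph.Walk.support_cons, List.mem_cons] at hv
    rcases hv with rfl | hv
    · exact hx
    · exact ih (siteGraph_adj_iff.1 h).2.2 hv

/-- `A_{N,D} ⊆ {ζ : 𝒮_ζ ⊂ ND}`. [folklore] -/
theorem approxSites_subset_squareSites (N : ℝ) (D : Set ℂ) :
    approxSites N D ⊆ squareSites N D := fun _ h => h.1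

/-- The origin belongs to `A_{N,D}` as soon as its square lies in `ND`. [folklore] -/
theorem zero_mem_approxSites {N : ℝ} {D : Set ℂ} (h : (0 : Site 2) ∈ squareSites N D) :
    (0 : Site 2) ∈ approxSites N D :=
  ⟨h, Relation.ReflTransGen.refl⟩

/-- The total mass of `P^N_{A,a,b}` before normalisation is `G_A(a₊, b₊)` (the fibres of the loop
erasure partition `𝒦_A(a₊, b₊)`; [LawlerViklund2021] §2.1: "`P̂_{A,a,b}[𝒲_A] = H_{∂A}(a,b)`", up to
the cancelled `1/16`). [cite: LawlerViklund2021, §2.1] -/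
theorem sum_smul_dirac_univ (N : ℝ) (A : Set (Site 2)) (a b : Site 2 × Site 2) :
    (Measure.sum fun ω : (siteGraph A).Walk a.2 b.2 =>
      (((1 : ℝ≥0∞) / 4) ^ ω.length) • Measure.dirac (scaledCurve N a b (loopErase ω.support)))
        Set.univ = rwGreen (siteGraph A) a.2 b.2 := by
  rw [Measure.sum_apply _ MeasurableSet.univ, rwGreen]
  refine tsum_congr fun ω => ?_
  simp

/-- Hence `P^N_{A,a,b}` is a probability measure whenever `0 < G_A(a₊,b₊) < ∞`. [folklore] -/
theorem isProbabilityMeasure_law {N : ℝ} {A : Set (Site 2)} {a b : Site 2 × Site 2}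
    (h0 : rwGreen (siteGraph A) a.2 b.2 ≠ 0) (htop : rwGreen (siteGraph A) a.2 b.2 ≠ ∞) :
    IsProbabilityMeasure (law N A a b) := by
  constructor
  rw [law, Measure.smul_apply, sum_smul_dirac_univ, smul_eq_mul, ENNReal.inv_mul_cancel h0 htop]

end ChordalLERW

end Literature.Probability.RandomPlanarGeometry
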